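import Summits.NavierStokesRegularity.NavierStokesRegularity.Theorems.ScenarioCensusRowF1Frozen
import Summits.NavierStokesRegularity.NavierStokesRegularity.Theorems.ScenarioCensusRowF1InviscidTop
import HarnessLib

/-!
# LINE «frozen-top» port, part 2/6: the NEW `C³_loc` convergence tool for Type-I mild sequences (§2, third part)

Re-homed for the scenario census (typer seat ns-census-typer-1 g8; the cells F1fzq ⊇ F1fz are MEMBERS OF RECORD «DECIDED IN KERNEL IN FILES» of row F1 since census
v1.72 (critic idea-crit-3 g7 PASS — no price 23:50:38Z; ref ns-census-ref g9 PRE-CHECK ✓ §14.21 item 32 (shim probe a49fdeaa); lead-presearch label); this port makes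
them TREE-decided): VERBATIM PORT of ns-idea-3 LINE 20 «frozen-top», `pub/ideators/ns-idea-3/lines/frozen-top/line-frozen-top.lean` sha16 edc3c151346cc4e4 (1610 l.,
0 sorry; the critic's / ref's farm runs went through a shim because the line's unused import `Literature.Analysis.FunctionSpaces.WeakTimeDerivativeClassical` has no
farm build — that import line is DROPPED here, nothing in the line refers to it), split for the 400-line rule into `ScenarioCensusRowF1Frozen` (§1–§2 with the `C²_loc`
tool) → `…FrozenThird` (`C³_loc`) → `…FrozenPairing` (§4a) → `…FrozenKill` (§4b) → `…FrozenTransfer` (§5–§6) → `…FrozenTop` (§7 + census KEYS).  Lean text VERBATIM in namespace `…Theorems.ScenarioCensus.FrozenTop` (the line's `…Cruxes.ScenarioCensusRowF1.FrozenTopLine`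
re-homed); port edits: the unused WTDC import dropped, `@[conjecture]` on the residual `FreezeSlack` (≡ `ScenarioCensus.Row_F1`, OPEN), five one-line docstrings
added (gate lint).

No census VALUE is moved here (row F1 stays OPEN-WITH-LINE; the members become TREE-decided by name); NS regularity is NOT proved; `Row_F1` is untouched
(zero movement, `freezeSlack_iff_rowF1`); no summit statement is proved by this file. Lemmas that restate already-landed tree declarations are taken BY NAME (gate lint `dedup.landed`): `fderiv_smul_stPull_apply` = `InviscidTop.fderiv_smul_stPull_apply`, `fderiv_smul_stPull` = `InviscidTop.fderiv_smul_stPull`, `fderiv_fderiv_smul_stPull` = `InviscidTop.fderiv_fderiv_smul_stPull`, `fderiv_fderiv_zoom` = `InviscidTop.fderiv_fderiv_zoom`, `tendsto_clm_of_tendsto_apply` = `InviscidTop.tendsto_clm_of_tendsto_apply`, `tendsto_fderiv_fderiv_apply_of_bound` = `InviscidTop.tendsto_fderiv_fderiv_apply_of_bound`, `tendsto_fderiv_fderiv_of_bound` = `InviscidTop.tendsto_fderiv_fderiv_of_bound`, `tendsto_fderiv_fderiv_of_typeI_seq_Ioo` = `InviscidTop.tendsto_fderiv_fderiv_of_typeI_seq_Ioo`,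 `tendsto_fderiv_fderiv_of_isTypeIAncientMild_seq` = `InviscidTop.tendsto_fderiv_fderiv_of_isTypeIAncientMild_seq`, `sing_of_not_bounded` = `InviscidTop.sing_of_not_bounded`, `tendsto_physicalTime` = `ColumnarTop.tendsto_physicalTime`, `eventually_fast` = `ColumnarTop.eventually_fast`, `sqrt_timeLag` = `StretchedTop.sqrt_timeLag`, `forall_of_forall_ne_zero` = `StretchedTop.forall_of_forall_ne_zero`.
-/

-- the summit and its single problem share the name `NavierStokesRegularity` (D-0017 nested layout)
set_option linter.dupNamespace false

noncomputable section

open MeasureTheory Set Function Filter TopologicalSpace Metric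
open scoped Topology NNReal ENNReal InnerProductSpace RealInnerProductSpace Laplacian

namespace Summit.NavierStokesRegularity.NavierStokesRegularity.Theorems.ScenarioCensus.FrozenTop

open Literature.Analysis Literature.Analysis.FluidPDE
open Summit.NavierStokesRegularity.NavierStokesRegularity.Theorems

/-! ### Third-order (`C³_loc`) convergence of Type-I mild sequences — this line's new extraction tool -/

/-- **`C³_loc` convergence along a `C¹_loc`-convergent sequence of Type-I Oseen-mild window fields**: the uniform
`D⁴` bound (KNSS 2009 (4.10), `k = 4`) and the `C²` tool applied to the GRADIENTS upgrade pointwise Hessian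
convergence (itself from the `C²` tool) to pointwise convergence of the THIRD derivatives. -/
theorem tendsto_fderiv3_of_typeI_seq_Ioo {C C' : ℝ} {A : ℕ → ℝ} (hA : Tendsto A atTop atBot)
    {w : ℕ → ℝ → E3 → E3}
    (hc : ∀ k, ContinuousOn (uncurry (w k)) (Ioo (A k) 0 ×ˢ univ))
    (hdivw : ∀ k, ∀ t ∈ Ioo (A k) 0, IsWeaklyDivFree (w k t))
    (hmild : ∀ k, ∀ s t : ℝ, A k < s → s < t → t < 0 → ∀ x,
      w k t x = UnboundedOperators.heatExtension (w k s) (t - s) x - oseenDuhamel 1 s (w k) (w k) t x)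
    (hI : ∀ k, ∀ t ∈ Ioo (A k) 0, ∀ x, ‖w k t x‖ ≤ C / Real.sqrt (-t))
    {W : ℝ → E3 → E3} (hW : IsTypeIAncientMild C' W)
    (hgrad : ∀ t < 0, ∀ x, Tendsto (fun k => fderiv ℝ (w k t) x) atTop (𝓝 (fderiv ℝ (W t) x))) :
    ∀ t < 0, ∀ x e, Tendsto (fun k => fderiv ℝ (fderiv ℝ (fderiv ℝ (w k t))) x e) atTop
      (𝓝 (fderiv ℝ (fderiv ℝ (fderiv ℝ (W t))) x e)) := by
  have hhess := InviscidTop.tendsto_fderiv_fderiv_of_typeI_seq_Ioo hA hc hdivw hmild hI hW hgrad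
  intro t ht x e
  have hab : t - 1 < t / 2 := by linarith
  have hb : t / 2 < 0 := by linarith
  obtain ⟨K, hK⟩ := exists_norm_iteratedFDeriv_le_of_typeI_Ioo C 4 hab hb one_pos
  obtain ⟨N, hN⟩ := eventually_atTop.1 (hA.eventually (eventually_lt_atBot (t - 1)))
  have hsm : ∀ k, ContDiffOn ℝ (⊤ : ℕ∞) (uncurry (w k)) (Ioo (A k) 0 ×ˢ univ) := fun k =>
    contDiffOn_of_Ioo (hc k) (hdivw k) (hmild k) (hI k)
  have htA : ∀ n, t ∈ Ioo (A (n + N)) 0 := fun n =>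
    ⟨by linarith [hN (n + N) (Nat.le_add_left N n)], ht⟩
  have hF4 : ∀ n, ContDiff ℝ 4 (w (n + N) t) := fun n =>
    ((hsm (n + N)).comp_contDiff (contDiff_prodMk_right t) fun y => ⟨htA n, mem_univ y⟩).of_le
      (by norm_cast)
  have hF : ∀ n, ContDiff ℝ 3 (fderiv ℝ (w (n + N) t)) := fun n => (hF4 n).fderiv_right (by norm_cast)
  have hF₀ : ContDiff ℝ 2 (fderiv ℝ (W t)) :=
    ((hW.contDiff_slice ht).of_le (by norm_cast : ((3 : ℕ) : WithTop ℕ∞) ≤ _)).fderiv_right (by norm_cast)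
  have h3 : ∀ n y, ‖iteratedFDeriv ℝ 3 (fderiv ℝ (w (n + N) t)) y‖ ≤ K := fun n y => by
    rw [norm_iteratedFDeriv_fderiv]
    exact hK (hN (n + N) (Nat.le_add_left N n)) (hc _) (hdivw _) (hmild _) (hI _) t
      ⟨by linarith, by linarith⟩ y
  have hg : ∀ y, Tendsto (fun n => fderiv ℝ (fderiv ℝ (w (n + N) t)) y) atTop
      (𝓝 (fderiv ℝ (fderiv ℝ (W t)) y)) :=
    fun y => (hhess t ht y).comp (tendsto_add_atTop_nat N)
  exact (tendsto_add_atTop_iff_nat N).1 (InviscidTop.tendsto_fderiv_fderiv_apply_of_bound hF hF₀ h3 hg x e)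

/-- **Convergence of the third-order data** `Σᵢ D³wₖ(t)(x) eᵢ eᵢ → Σᵢ D³W(t)(x) eᵢ eᵢ`. -/
theorem tendsto_lapD_of_typeI_seq_Ioo {C C' : ℝ} {A : ℕ → ℝ} (hA : Tendsto A atTop atBot)
    {w : ℕ → ℝ → E3 → E3}
    (hc : ∀ k, ContinuousOn (uncurry (w k)) (Ioo (A k) 0 ×ˢ univ))
    (hdivw : ∀ k, ∀ t ∈ Ioo (A k) 0, IsWeaklyDivFree (w k t))
    (hmild : ∀ k, ∀ s t : ℝ, A k < s → s < t → t < 0 → ∀ x,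
      w k t x = UnboundedOperators.heatExtension (w k s) (t - s) x - oseenDuhamel 1 s (w k) (w k) t x)
    (hI : ∀ k, ∀ t ∈ Ioo (A k) 0, ∀ x, ‖w k t x‖ ≤ C / Real.sqrt (-t))
    {W : ℝ → E3 → E3} (hW : IsTypeIAncientMild C' W)
    (hgrad : ∀ t < 0, ∀ x, Tendsto (fun k => fderiv ℝ (w k t) x) atTop (𝓝 (fderiv ℝ (W t) x))) :
    ∀ t < 0, ∀ x, Tendsto (fun k => lapD (w k t) x) atTop (𝓝 (lapD (W t) x)) := by
  intro t ht x
  unfold lapD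
  refine tendsto_finsetSum _ fun i _ => ?_
  exact ((ContinuousLinearMap.apply ℝ (E3 →L[ℝ] E3) (eI i)).continuous.tendsto _).comp
    (tendsto_fderiv3_of_typeI_seq_Ioo hA hc hdivw hmild hI hW hgrad t ht x (eI i))

/-- **`C³_loc` convergence of the third-order data in the Type-I ancient mild class `𝒦_C`.** -/
theorem tendsto_lapD_of_isTypeIAncientMild_seq {C : ℝ} {v : ℕ → ℝ → E3 → E3}
    (hv : ∀ n, IsTypeIAncientMild C (v n)) {U : ℝ → E3 → E3} (hU : IsTypeIAncientMild C U)
    (hgrad : ∀ s < 0, ∀ y, Tendsto (fun n => fderiv ℝ (v n s) y) atTop (𝓝 (fderiv ℝ (U s) y))) :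
    ∀ s < 0, ∀ y, Tendsto (fun n => lapD (v n s) y) atTop (𝓝 (lapD (U s) y)) := by
  have hA : Tendsto (fun n : ℕ => -((n : ℝ) + 1)) atTop atBot :=
    tendsto_neg_atTop_atBot.comp (tendsto_atTop_add_const_right _ _ tendsto_natCast_atTop_atTop)
  exact tendsto_lapD_of_typeI_seq_Ioo (C := C) hA
    (fun n => (hv n).continuousOn_uncurry.mono (prod_mono Ioo_subset_Iio_self Subset.rfl))
    (fun n t ht => (hv n).isWeaklyDivFree ht.2)
    (fun n s t _ hst ht x => (hv n).mild_eq_heatExtension hst ht x)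
    (fun n t ht x => (hv n).norm_le ht.2 x) hU hgrad

/-- **The singular Type-I zoom package with Hessians and third-order data** (`M`-normalised): at a backward-singular point
`(T, x₀)` of a Type-I(`M`) Clay solution there are `α, β, R > 0` with `α R = β`, `α √ν = √β`, scales
`c_j ↓ 0` and a NONTRIVIAL `W ∈ 𝒦_M` with `(c_j α) u(T + c_j² β t, x₀ + c_j R y) → W(t, y)`,
`(c_j α)(c_j R) ∇u(…) → ∇W(t, y)` `(c_j α)(c_j R)² ∇²u(…) → ∇²W(t, y)` AND `(c_j α)(c_j R)³ Σᵢ D³u(…) eᵢ eᵢ → Σᵢ D³W(t, y) eᵢ eᵢ` pointwise on the open past.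
(refs: AlbrittonBarker2019 §3; KochNadirashviliSereginSverak2009 Lemma 6.1, (4.10)) -/
theorem exists_singularZoom_package₃ {ν T M : ℝ} (hν : 0 < ν) (hT : 0 < T)
    {u : ℝ → E3 → E3} {p : ℝ → E3 → ℝ}
    (hsol : IsClassicalNSSolutionOn (Ico 0 T) ν 0 u p) (hLH : IsLerayHopfOn T ν 0 (u 0) u)
    (hdec : HasRapidSpatialDecay (u 0)) (hMν : IsTypeIBlowupWith M ν u T) (x₀ : E3)
    (hsing : ∀ r : ℝ, 0 < r →
      eLpNorm (uncurry u) ∞ (volume.restrict (parabolicCylinder r ((T : ℝ), x₀))) = ∞) :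
    ∃ (α β R : ℝ) (c : ℕ → ℝ) (W : ℝ → E3 → E3),
      0 < α ∧ 0 < β ∧ 0 < R ∧ α * R = β ∧ α * Real.sqrt ν = Real.sqrt β ∧
      (∀ j, 0 < c j) ∧ Tendsto c atTop (𝓝 0) ∧
      IsTypeIAncientMild M W ∧
      (∀ t < 0, ∀ y : E3,
        Tendsto (fun j => (c j * α) • u (T + c j ^ 2 * β * t) (x₀ + (c j * R) • y)) atTop (𝓝 (W t y))) ∧
      (∀ t < 0, ∀ y : E3,
        Tendsto (fun j => (c j * α * (c j * R)) • fderiv ℝ (u (T + c j ^ 2 * β * t)) (x₀ + (c j * R) • y))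
          atTop (𝓝 (fderiv ℝ (W t) y))) ∧
      (∀ t < 0, ∀ y : E3,
        Tendsto (fun j => (c j * α * (c j * R) * (c j * R)) •
            fderiv ℝ (fderiv ℝ (u (T + c j ^ 2 * β * t))) (x₀ + (c j * R) • y))
          atTop (𝓝 (fderiv ℝ (fderiv ℝ (W t)) y))) ∧
      (∀ t < 0, ∀ y : E3,
        Tendsto (fun j => (c j * α * (c j * R) * (c j * R) * (c j * R)) •
            lapD (u (T + c j ^ 2 * β * t)) (x₀ + (c j * R) • y))
          atTop (𝓝 (lapD (W t) y))) ∧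
      ∃ t < 0, ∃ y, W t y ≠ 0 := by
  -- ## (1) the Type-I(`M`) rate window, the Morrey bound and the unit zoom at `(T, x₀)`
  have hTI : IsTypeIBlowup u T := hMν.isTypeIBlowup
  obtain ⟨T₂, hT₂, hsub⟩ := (mem_nhdsLT_iff_exists_Ioo_subset).1 hMν
  set δ : ℝ := min (T - T₂) T with hδdef
  have hδ : 0 < δ := lt_min (sub_pos.2 hT₂) hT
  have hδT : δ ≤ T := min_le_right _ _
  have hrate : ∀ t ∈ Ioo (T - δ) T, ∀ x, Real.sqrt (T - t) * ‖u t x‖ ≤ M * Real.sqrt ν := by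
    intro t ht x
    have h1 : δ ≤ T - T₂ := min_le_left _ _
    have ht2 : T₂ < t := by linarith [ht.1]
    exact hsub ⟨ht2, ht.2⟩ x
  obtain ⟨r₀, M₀, T₁, hr₀, hT₁, hMor⟩ := morrey_of_typeI hν hT hsol hLH hTI
  obtain ⟨R, α, β, hR, hα, hβ, hβeq, hαeq, hβT, hball, hGv, htypeI⟩ :=
    exists_zoom_typeIBound_lt_top_of_morrey hν hT hsol hLH hr₀ hT₁ hMor x₀
  have hαR : α * R = β := by
    rw [hαeq, hβeq]
    ring
  have hsν : 0 < Real.sqrt ν := Real.sqrt_pos.2 hν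
  have hαν : α * Real.sqrt ν = Real.sqrt β := by
    rw [hαeq, hβeq, Real.sqrt_div (sq_nonneg R), Real.sqrt_sq hR.le, div_mul_eq_mul_div,
      div_eq_div_iff hν.ne' hsν.ne', mul_assoc, Real.mul_self_sqrt hν.le]
  set v : ℝ → E3 → E3 := α • stPull β R T x₀ u with hv
  set πv : ℝ → E3 → ℝ :=
    α ^ 2 • stPull β R T x₀ (fun t x => p t x - (p t 0 - normalisedPressure (u t) 0)) with hπv
  set Gv : ℝ → E3 → E3 →L[ℝ] E3 :=
    (α * R) • stPull β R T x₀ (fun t x => fderiv ℝ (u t) x) with hGvdef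
  set I₀ : ℝ≥0∞ := typeIBound (parabolicCylinder (1 / 2) (0 : ℝ × E3)) v πv Gv with hI₀
  have hI₀top : I₀ ≠ ⊤ := htypeI.ne
  -- ## (2) the scales `c k = 1/(k+4) ↓ 0` and the zoom sequence
  set c : ℕ → ℝ := fun k => 1 / ((k : ℝ) + 4) with hc
  have hcpos : ∀ k, 0 < c k := fun k => by simp only [hc]; positivity
  have hc4 : ∀ k, c k ≤ 1 / 4 := fun k =>
    div_le_div_of_nonneg_left zero_le_one (by norm_num) (by linarith [(Nat.cast_nonneg k : (0 : ℝ) ≤ k)])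
  have hc2 : ∀ k, c k ≤ 1 / 2 := fun k => (hc4 k).trans (by norm_num)
  have hclim : Tendsto c atTop (𝓝 0) :=
    tendsto_const_nhds.div_atTop (tendsto_atTop_add_const_right _ _ tendsto_natCast_atTop_atTop)
  set w : ℕ → ℝ → E3 → E3 :=
    fun k => (c k * α) • stPull (c k ^ 2 * β) (c k * R) T x₀ u with hw
  set Aw : ℕ → ℝ := fun k => -(δ / (c k ^ 2 * β)) with hA
  have hAk : ∀ k, Aw k = -(δ / β * ((k : ℝ) + 4) ^ 2) := by
    intro k
    simp only [hA, hc]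
    field_simp
  have hAlim : Tendsto Aw atTop atBot := by
    have h1 : Tendsto (fun k : ℕ => ((k : ℝ) + 4) ^ 2) atTop atTop :=
      (tendsto_pow_atTop two_ne_zero).comp
        (tendsto_atTop_add_const_right _ _ tendsto_natCast_atTop_atTop)
    have h2 : Tendsto (fun k : ℕ => δ / β * ((k : ℝ) + 4) ^ 2) atTop atTop :=
      h1.const_mul_atTop (by positivity)
    refine (tendsto_neg_atTop_atBot.comp h2).congr fun k => ?_
    rw [hAk k]
    rfl
  -- ## (3) per-scale facts
  have hcW : ∀ k, ContinuousOn (uncurry (w k)) (Ioo (Aw k) 0 ×ˢ univ) := fun k =>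
    zoom_continuousOn hν hsol hR hαeq hβeq (hcpos k) hδT
  have hdivW : ∀ k, ∀ t ∈ Ioo (Aw k) 0, IsWeaklyDivFree (w k t) := fun k t ht =>
    zoom_isWeaklyDivFree hν hsol hR hαeq hβeq (hcpos k) hδT ht
  have hmildW : ∀ k, ∀ s t : ℝ, Aw k < s → s < t → t < 0 → ∀ y,
      w k t y = UnboundedOperators.heatExtension (w k s) (t - s) y -
        oseenDuhamel 1 s (w k) (w k) t y := fun k s t hs hst ht y =>
    zoom_oseen hν hT hsol hLH hdec hR hαeq hβeq (hcpos k) hδT hs hst ht y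
  set C₁ : ℝ := α * (M * Real.sqrt ν) / Real.sqrt β with hC₁
  have hC₁M : C₁ = M := by
    rw [hC₁, ← hαν]
    field_simp
  have hIW : ∀ k, ∀ t ∈ Ioo (Aw k) 0, ∀ y, ‖w k t y‖ ≤ C₁ / Real.sqrt (-t) := fun k t ht y =>
    zoom_norm_le hR hαeq hβeq hν (hcpos k) hδT hrate ht y
  -- ## (4) extraction of the `C¹_loc` limit `W ∈ 𝒦_{C₁} = 𝒦_M`, then the Hessian upgrade (§2)
  obtain ⟨φ, hφ, W, hWclass, hpt, hgrad, -, -⟩ :=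
    exists_tendsto_of_typeI_seq_Ioo C₁ hAlim hcW hdivW hmildW hIW
  have hφt : Tendsto φ atTop atTop := hφ.tendsto_atTop
  have hhess := InviscidTop.tendsto_fderiv_fderiv_of_typeI_seq_Ioo (C := C₁) (hAlim.comp hφt)
    (fun j => hcW (φ j)) (fun j => hdivW (φ j)) (fun j => hmildW (φ j)) (fun j => hIW (φ j))
    hWclass hgrad
  have hlap := tendsto_lapD_of_typeI_seq_Ioo (C := C₁) (hAlim.comp hφt)
    (fun j => hcW (φ j)) (fun j => hdivW (φ j)) (fun j => hmildW (φ j)) (fun j => hIW (φ j))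
    hWclass hgrad
  rw [hC₁M] at hWclass
  have hcφ : Tendsto (fun j => c (φ j)) atTop (𝓝 0) := hclim.comp hφt
  -- ## (5) `W` is unbounded at the origin
  have hsingW : ∀ r > 0, ∀ M' : ℝ, ∃ t ∈ Ioo (-(r ^ 2)) (0 : ℝ),
      ∃ x ∈ ball (0 : E3) r, M' < ‖W t x‖ :=
    zoomSeq_unbounded_at_origin (πv := πv) hsol hR hα hβ hβT hsing hball hGv hI₀top
      (fun j => hcpos (φ j)) (fun j => hc2 (φ j)) fun z hz =>
        hpt z.1 ((SuitableCompactness.mem_parabolicCylinder_zero.1 hz).1.2) z.2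
  have hwu : ∀ (j : ℕ) (t : ℝ) (y : E3),
      w (φ j) t y = (c (φ j) * α) • u (T + c (φ j) ^ 2 * β * t) (x₀ + (c (φ j) * R) • y) :=
    fun j t y => by simp only [hw, smul_stPull_apply]
  have hwD : ∀ (j : ℕ) (t : ℝ) (y : E3),
      fderiv ℝ (w (φ j) t) y = (c (φ j) * α * (c (φ j) * R)) •
        fderiv ℝ (u (T + c (φ j) ^ 2 * β * t)) (x₀ + (c (φ j) * R) • y) := by
    intro j t y
    have e1 : w (φ j) t = ((c (φ j) * α) • stPull (c (φ j) ^ 2 * β) (c (φ j) * R) T x₀ u) t := by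
      simp only [hw]
    rw [e1, InviscidTop.fderiv_smul_stPull_apply]
  have hwDD : ∀ (j : ℕ) (t : ℝ) (y : E3),
      fderiv ℝ (fderiv ℝ (w (φ j) t)) y = (c (φ j) * α * (c (φ j) * R) * (c (φ j) * R)) •
        fderiv ℝ (fderiv ℝ (u (T + c (φ j) ^ 2 * β * t))) (x₀ + (c (φ j) * R) • y) := by
    intro j t y
    have e1 : w (φ j) t = ((c (φ j) * α) • stPull (c (φ j) ^ 2 * β) (c (φ j) * R) T x₀ u) t := by
      simp only [hw]
    rw [e1, InviscidTop.fderiv_fderiv_smul_stPull]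
  have hwDDD : ∀ (j : ℕ) (t : ℝ) (y : E3),
      lapD (w (φ j) t) y = (c (φ j) * α * (c (φ j) * R) * (c (φ j) * R) * (c (φ j) * R)) •
        lapD (u (T + c (φ j) ^ 2 * β * t)) (x₀ + (c (φ j) * R) • y) := by
    intro j t y
    have e1 : w (φ j) t = ((c (φ j) * α) • stPull (c (φ j) ^ 2 * β) (c (φ j) * R) T x₀ u) t := by
      simp only [hw]
    rw [e1, lapD_smul_stPull]
  -- ## (6) package
  obtain ⟨ts, hts, xs, -, hM'⟩ := hsingW 1 one_pos 0
  have hne : W ts xs ≠ 0 := by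
    intro h0; rw [h0, norm_zero] at hM'; exact lt_irrefl _ hM'
  exact ⟨α, β, R, fun j => c (φ j), W, hα, hβ, hR, hαR, hαν, fun j => hcpos _, hcφ, hWclass,
    fun t ht y => (hpt t ht y).congr fun j => hwu j t y,
    fun t ht y => (hgrad t ht y).congr fun j => hwD j t y,
    fun t ht y => (hhess t ht y).congr fun j => hwDD j t y,
    fun t ht y => (hlap t ht y).congr fun j => hwDDD j t y, ts, hts.2, xs, hne⟩

end Summit.NavierStokesRegularity.NavierStokesRegularity.Theorems.ScenarioCensus.FrozenTop

end
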